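import Summits.RiemannHypothesis.RiemannHypothesis.Theorems.SoloInformedSizeLaw
import Summits.RiemannHypothesis.RiemannHypothesis.Theorems.SoloInformedQuasiWeilCriterion
import Literature.NumberTheory.LFunctions.WeilGroundEnergyParitySplit
import Literature.NumberTheory.LFunctions.WeilGroundEnergyProofs
import Literature.NumberTheory.LFunctions.UniformWeilPositivityRH
import HarnessLib

/-!
# The logical status of the «lower slope law» for the Weil ground energy

TRACK «HANDOFF», seat handoff-theory-1 (H-T, statement owner), file XVII: the custody placement of
route R-E of `HOME/handoff/IDEAS-finite-rank.md` PART G19 (handoff-idea-3 gen19).  Sorry-free,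
standard axioms, no new analysis — bookkeeping on tree theorems.

`ε(a) = weilGroundEnergy a` is the bottom of Weil's quadratic form over unit test functions on the
window `[-a, a]`; `RH ⟺ ∀ a > 0, 0 ≤ ε(a)` (Weil–Bombieri–Yoshida, tree).  Route R-E types

  `LowerSlopeLaw c := ∃ K a₀, ∀ a ≥ a₀, log (log (ε a)⁻¹) ≤ c·a + K`

and asserts `RH → (Montgomery 1973 facts) → ∀ θ > 0, LowerSlopeLaw (12/5 + θ)`, sharpening the
slope `A` of the tree's `log_log_inv_weilGroundEnergy_of_riemannHypothesis` (whose statement carries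
the extra conjunct `0 < ε a`).  This file records the EXACT LOGICAL STATUS of the typed sentence:

* §1 `weilGroundEnergy_le_neg_of_not_riemannHypothesis` — under `¬RH` the bottom is eventually
  `≤ −e < 0` (Yoshida's criterion and antitonicity in the window); unconditionally it is
  `≥ −C(1+a)e^a` (Bombieri's a-priori bound, tree `weilGroundEnergy_ge_neg_exp`).
* §2 `log_log_inv_weilGroundEnergy_le_of_not_riemannHypothesis` — hence, `Real.log` being
  `log |·|` off the positive axis, **under `¬RH` the bare inequality `log (log (ε a)⁻¹) ≤ c·a + K`
  holds eventually for EVERY slope `c > 0`** (the inner logarithm has modulus `≤ (C+1)a + β`).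
* §3 `lowerSlope_iff_riemannHypothesis_imp` — so for `c > 0` the bare law is UNCONDITIONALLY
  EQUIVALENT to its own RH-conditional form (it can never test RH), and
  `exists_slope_log_log_inv_weilGroundEnergy_le` — for SOME slope it is an outright theorem.
* §4 the SIGN-AWARE law (`0 < ε a ∧ …`, the tree's typing) implies RH from its first conjunct
  alone and is equivalent to `RH ∧ bare law` (`signAware_lowerSlope_iff`); for every slope past an
  absolute `A` it is equivalent to RH itself (`exists_slope_signAware_iff_riemannHypothesis`).
* §5–§6 (APPEND, theory-1 gen15; referee HS-35 (c)): THE FULL TABLE IN THE SLOPE.  Under RH the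
  tree's two-sided law gives `2a − K ≤ log (log (ε a)⁻¹)`, so the bare law FAILS for every `c < 2` in
  an RH world (`not_lowerSlope_of_riemannHypothesis_of_lt_two`); under `¬RH` the bottom is unbounded
  below, so it FAILS for every `c ≤ 0` in a `¬RH` world.  Hence: **`c ≤ 0` — the bare law is FALSE
  outright** (`not_lowerSlope_of_nonpos`; so §3's equivalence there is equivalent to RH, NOT
  unconditional: `lowerSlope_iff_imp_iff_riemannHypothesis_of_nonpos`); **`0 < c < 2` — the bare law
  IS `¬RH`** (`lowerSlope_iff_not_riemannHypothesis`); `c ≥ 2` — §3 (open on `[2, A)`, theorem past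
  `A`); and the sign-aware law is FALSE for every `c < 2` (`not_signAware_lowerSlope_of_lt_two`).

Reading (LOGIC-CARD, row «size laws»): R-E is a statement about the SIZE of the positive margin in
an RH world — the lower companion of the RH-free upper law `weilGroundEnergy_exp_exp_decay`
(slope `2`) — and in either typing carries no logical weight toward RH: bare ⟹ silent, sign-aware
⟹ `≥ RH`.  Nothing here bears on the truth of RH.
-/

noncomputable section

set_option linter.dupNamespace false  -- the mandated namespace repeats `RiemannHypothesis`

open Real Set Literature.NumberTheory.LFunctions

namespace Summit.RiemannHypothesis.RiemannHypothesis.Theorems.HandoffLowerSlope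

open Summit.RiemannHypothesis.RiemannHypothesis.Theorems

/-! ## §1  The bottom in a `¬RH` world: eventually `≤ −e < 0` -/

/-- Under `¬RH` the window bottom is eventually NEGATIVE AND BOUNDED AWAY FROM ZERO: there are
`a₁ > 0` and `e > 0` with `ε(a) ≤ −e` for every `a ≥ a₁` (Yoshida's criterion
`riemannHypothesis_iff_forall_weilPositivityOn` gives one window with `ε(a₁) < 0`; `ε` is antitone in
the window, `weilGroundEnergy_anti`). -/
theorem weilGroundEnergy_le_neg_of_not_riemannHypothesis (h : ¬ _root_.RiemannHypothesis) :
    ∃ a₁ e : ℝ, 0 < a₁ ∧ 0 < e ∧ ∀ a : ℝ, a₁ ≤ a → weilGroundEnergy a ≤ -e := by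
  rw [riemannHypothesis_iff_forall_weilPositivityOn] at h
  push Not at h
  obtain ⟨a₁, ha₁, hna⟩ := h
  have hneg : weilGroundEnergy a₁ < 0 :=
    lt_of_not_ge fun h0 ↦ hna ((weilGroundEnergy_nonneg_iff_holds ha₁).1 h0)
  refine ⟨a₁, -weilGroundEnergy a₁, ha₁, neg_pos.2 hneg, fun a ha ↦ ?_⟩
  rw [neg_neg]
  exact weilGroundEnergy_anti ha₁ ha

/-! ## §2  The bare double-logarithmic inequality is `¬RH`-trivial -/

/-- `log x ≤ log M` whenever `|x| ≤ M` and `1 ≤ M` — for EVERY real `x`, the non-positive ones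
included (`Real.log x = Real.log |x|`, `Real.log 0 = 0`). -/
theorem log_le_log_of_abs_le {x M : ℝ} (hM : 1 ≤ M) (h : |x| ≤ M) :
    Real.log x ≤ Real.log M := by
  rw [← Real.log_abs]
  rcases (abs_nonneg x).eq_or_lt with h0 | h0
  · rw [← h0, Real.log_zero]
    exact Real.log_nonneg hM
  · exact Real.log_le_log h0 h

/-- An affine envelope has a logarithm below any prescribed positive slope:
`log (α a + β) ≤ c·a + (cβ/α − 1 − log (c/α))` for `α, c > 0` and `α a + β > 0`
(`log y ≤ y − 1` at `y = (c/α)(α a + β)`). -/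
theorem log_affine_le {α β c a : ℝ} (hα : 0 < α) (hc : 0 < c) (hB : 0 < α * a + β) :
    Real.log (α * a + β) ≤ c * a + (c / α * β - 1 - Real.log (c / α)) := by
  have hcα : 0 < c / α := div_pos hc hα
  have h1 := Real.log_le_sub_one_of_pos (mul_pos hcα hB)
  rw [Real.log_mul hcα.ne' hB.ne'] at h1
  have h2 : c / α * (α * a + β) = c * a + c / α * β := by
    field_simp
  linarith

/-- **Under `¬RH` the bare lower slope law holds for EVERY slope.**  If RH fails then for every
`c > 0` there are `K, a₀` with `log (log (ε a)⁻¹) ≤ c·a + K` for all `a ≥ a₀`.  Reason: `ε(a)` is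
eventually negative with `e ≤ |ε(a)| ≤ C(1+a)e^a ≤ exp((C+1)a + C)` (§1 and the tree's unconditional
floor `weilGroundEnergy_ge_neg_exp`), so the inner logarithm `log (ε a)⁻¹ = −log |ε a|` has modulus
at most `(C+1)a + C + |log e|`, and the outer `Real.log` of a real of that modulus is
`≤ log ((C+1)a + β) ≤ c·a + K`.  The sentence says nothing about primes or zeros in this branch:
it is an artefact of typing the law without the conjunct `0 < ε a`. -/
theorem log_log_inv_weilGroundEnergy_le_of_not_riemannHypothesis
    (h : ¬ _root_.RiemannHypothesis) {c : ℝ} (hc : 0 < c) :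
    ∃ K a₀ : ℝ, ∀ a : ℝ, a₀ ≤ a →
      Real.log (Real.log (weilGroundEnergy a)⁻¹) ≤ c * a + K := by
  obtain ⟨a₁, e, ha₁, he, hle⟩ := weilGroundEnergy_le_neg_of_not_riemannHypothesis h
  obtain ⟨C, hC0, hfloor⟩ := weilGroundEnergy_ge_neg_exp
  -- envelope of the inner logarithm: `|log (ε a)⁻¹| ≤ α a + β`
  set α : ℝ := C + 1 with hα
  set β : ℝ := C + |Real.log e| with hβ
  have hαpos : 0 < α := by rw [hα]; linarith
  have hβnn : 0 ≤ β := by rw [hβ]; positivity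
  refine ⟨c / α * β - 1 - Real.log (c / α), max a₁ 1, fun a ha ↦ ?_⟩
  have ha₁a : a₁ ≤ a := le_trans (le_max_left _ _) ha
  have ha1 : 1 ≤ a := le_trans (le_max_right _ _) ha
  have ha0 : 0 < a := by linarith
  have hεle : weilGroundEnergy a ≤ -e := hle a ha₁a
  have hεge : -(C * (1 + a) * Real.exp a) ≤ weilGroundEnergy a := hfloor a ha0
  have habs : |weilGroundEnergy a| = -weilGroundEnergy a := abs_of_neg (by linarith)
  have hlow : e ≤ |weilGroundEnergy a| := by rw [habs]; linarith
  have habspos : 0 < |weilGroundEnergy a| := lt_of_lt_of_le he hlow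
  have hup : |weilGroundEnergy a| ≤ Real.exp (α * a + C) := by
    rw [habs]
    have h1 : C * (1 + a) ≤ Real.exp (C * (1 + a)) := by
      linarith [Real.add_one_le_exp (C * (1 + a))]
    have h2 : C * (1 + a) * Real.exp a ≤ Real.exp (C * (1 + a)) * Real.exp a :=
      mul_le_mul_of_nonneg_right h1 (Real.exp_pos a).le
    rw [← Real.exp_add] at h2
    have h3 : C * (1 + a) + a = α * a + C := by rw [hα]; ring
    rw [h3] at h2
    linarith
  -- `log |ε a| ∈ [log e, α a + C]`
  have hlog_up : Real.log |weilGroundEnergy a| ≤ α * a + C := by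
    rw [Real.log_le_iff_le_exp habspos]
    exact hup
  have hlog_low : Real.log e ≤ Real.log |weilGroundEnergy a| := Real.log_le_log he hlow
  -- the inner logarithm is `-log |ε a|`
  have hL : Real.log (weilGroundEnergy a)⁻¹ = -Real.log |weilGroundEnergy a| := by
    rw [Real.log_inv, Real.log_abs]
  have hαa : 0 ≤ α * a := mul_nonneg hαpos.le ha0.le
  have hB1 : 1 ≤ α * a + β := by
    have h1 : (1 : ℝ) ≤ α := by rw [hα]; linarith
    have h2 : α ≤ α * a := le_mul_of_one_le_right hαpos.le ha1
    linarith
  have hinner : |Real.log (weilGroundEnergy a)⁻¹| ≤ α * a + β := by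
    rw [hL, abs_neg, abs_le]
    have h1 : -|Real.log e| ≤ Real.log e := neg_abs_le _
    constructor
    · rw [hβ]; linarith
    · rw [hβ]; linarith [abs_nonneg (Real.log e)]
  calc Real.log (Real.log (weilGroundEnergy a)⁻¹)
      ≤ Real.log (α * a + β) := log_le_log_of_abs_le hB1 hinner
    _ ≤ c * a + (c / α * β - 1 - Real.log (c / α)) := log_affine_le hαpos hc (by linarith)

/-! ## §3  Status of the bare law: unconditionally equivalent to its RH-conditional form -/

/-- **The bare lower slope law with slope `c > 0` is unconditionally equivalent to
`RH → (the same law)`.**  So a proof of `RH → … → LowerSlopeLaw c` (route R-E's `Target_E125`,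
`Target_E2`) proves the bare sentence OUTRIGHT, and the bare sentence can never be used to test RH:
it holds in every `¬RH` world (§2). -/
theorem lowerSlope_iff_riemannHypothesis_imp {c : ℝ} (hc : 0 < c) :
    (∃ K a₀ : ℝ, ∀ a : ℝ, a₀ ≤ a →
        Real.log (Real.log (weilGroundEnergy a)⁻¹) ≤ c * a + K) ↔
      (_root_.RiemannHypothesis → ∃ K a₀ : ℝ, ∀ a : ℝ, a₀ ≤ a →
        Real.log (Real.log (weilGroundEnergy a)⁻¹) ≤ c * a + K) := by
  refine ⟨fun h _ ↦ h, fun h ↦ ?_⟩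
  by_cases hRH : _root_.RiemannHypothesis
  · exact h hRH
  · exact log_log_inv_weilGroundEnergy_le_of_not_riemannHypothesis hRH hc

/-- **For SOME slope the bare law is an unconditional theorem**: there are `A > 0`, `K`, `a₀` with
`log (log (ε a)⁻¹) ≤ A·a + K` for all `a ≥ a₀` — under RH by the tree's size law
`log_log_inv_weilGroundEnergy_of_riemannHypothesis` (slope `A`, the kernel constant of E3), under
`¬RH` by §2 (any slope).  The double logarithm is genuine only in the first branch. -/
theorem exists_slope_log_log_inv_weilGroundEnergy_le :
    ∃ A K a₀ : ℝ, 0 < A ∧ ∀ a : ℝ, a₀ ≤ a →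
      Real.log (Real.log (weilGroundEnergy a)⁻¹) ≤ A * a + K := by
  by_cases hRH : _root_.RiemannHypothesis
  · obtain ⟨A, K, a₀, hA, h⟩ := log_log_inv_weilGroundEnergy_of_riemannHypothesis hRH
    exact ⟨A, 0, a₀, hA, fun a ha ↦ by linarith [(h a ha).2.2]⟩
  · obtain ⟨K, a₀, h⟩ := log_log_inv_weilGroundEnergy_le_of_not_riemannHypothesis hRH one_pos
    exact ⟨1, K, a₀, one_pos, h⟩

/-! ## §4  The sign-aware law is `≥ RH` -/

/-- Eventual POSITIVITY of the window bottom gives RH (no lower threshold on `a₀` needed: the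
windows are nested, `WeilPositivityOn.mono`).  Variant of the tree's
`riemannHypothesis_of_eventually_weilGroundEnergy_nonneg`. -/
theorem riemannHypothesis_of_eventually_weilGroundEnergy_pos' {a₀ : ℝ}
    (h : ∀ a : ℝ, a₀ ≤ a → 0 < weilGroundEnergy a) : _root_.RiemannHypothesis := by
  rw [riemannHypothesis_iff_forall_weilPositivityOn]
  intro a _
  set b : ℝ := max a (max a₀ 1) with hb
  have hb0 : 0 < b :=
    lt_of_lt_of_le one_pos (le_trans (le_max_right _ _) (le_max_right _ _))
  have hb₀ : a₀ ≤ b := le_trans (le_max_left _ _) (le_max_right _ _)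
  have hpos : 0 ≤ weilGroundEnergy b := (h b hb₀).le
  exact WeilPositivityOn.mono (le_max_left _ _) ((weilGroundEnergy_nonneg_iff_holds hb0).1 hpos)

/-- **The SIGN-AWARE lower slope law ⟺ RH ∧ the bare law.**  With the conjunct `0 < ε a` (the
tree's typing in `log_log_inv_weilGroundEnergy_of_riemannHypothesis`) the law implies RH from that
conjunct alone (`riemannHypothesis_of_eventually_weilGroundEnergy_pos'`); conversely under RH the
bottom is positive on every window `a ≥ 1` (`exp_neg_exp_le_weilGroundEnergy_of_riemannHypothesis`).
So the sign-aware reading of route R-E is `≥ RH`, the bare reading is silent (§3): no typing of a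
lower SIZE law for the margin is both RH-free-provable and RH-yielding. -/
theorem signAware_lowerSlope_iff (c : ℝ) :
    (∃ K a₀ : ℝ, ∀ a : ℝ, a₀ ≤ a →
        0 < weilGroundEnergy a ∧ Real.log (Real.log (weilGroundEnergy a)⁻¹) ≤ c * a + K) ↔
      _root_.RiemannHypothesis ∧
        ∃ K a₀ : ℝ, ∀ a : ℝ, a₀ ≤ a →
          Real.log (Real.log (weilGroundEnergy a)⁻¹) ≤ c * a + K := by
  constructor
  · rintro ⟨K, a₀, h⟩
    exact ⟨riemannHypothesis_of_eventually_weilGroundEnergy_pos' fun a ha ↦ (h a ha).1,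
      K, a₀, fun a ha ↦ (h a ha).2⟩
  · rintro ⟨hRH, K, a₀, hK⟩
    obtain ⟨A, _, hlow⟩ := exp_neg_exp_le_weilGroundEnergy_of_riemannHypothesis hRH
    refine ⟨K, max a₀ 1, fun a ha ↦ ⟨?_, hK a (le_trans (le_max_left _ _) ha)⟩⟩
    exact lt_of_lt_of_le (Real.exp_pos _) (hlow a (le_trans (le_max_right _ _) ha))

/-- **Past an absolute slope the sign-aware law IS RH.**  There is `A > 0` such that for every
`c ≥ A` the sign-aware law with slope `c` is EQUIVALENT to RH (the bare part being an unconditional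
theorem there, §3).  Below `A` — e.g. at R-E's `12/5 + θ` — it is `RH ∧ (an RH-conditional size
statement)`: proving it is proving RH and more; it is not a door. -/
theorem exists_slope_signAware_iff_riemannHypothesis :
    ∃ A : ℝ, 0 < A ∧ ∀ c : ℝ, A ≤ c →
      ((∃ K a₀ : ℝ, ∀ a : ℝ, a₀ ≤ a →
          0 < weilGroundEnergy a ∧ Real.log (Real.log (weilGroundEnergy a)⁻¹) ≤ c * a + K) ↔
        _root_.RiemannHypothesis) := by
  obtain ⟨A, K, a₀, hA, h⟩ := exists_slope_log_log_inv_weilGroundEnergy_le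
  refine ⟨A, hA, fun c hc ↦ ?_⟩
  rw [signAware_lowerSlope_iff c]
  refine ⟨fun h' ↦ h'.1, fun hRH ↦ ⟨hRH, K, max a₀ 0, fun a ha ↦ ?_⟩⟩
  have ha0 : 0 ≤ a := le_trans (le_max_right _ _) ha
  have h1 := h a (le_trans (le_max_left _ _) ha)
  have h2 : A * a ≤ c * a := mul_le_mul_of_nonneg_right hc ha0
  linarith

/-! ## §5  Slopes below `2` in an RH world, non-positive slopes in a `¬RH` world (APPEND, theory-1 gen15; referee HS-35 (c))

Referee r39, HS-35 (c): §3's «unconditionally» means «for every `c > 0`» — the hypothesis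
`(hc : 0 < c)` of `lowerSlope_iff_riemannHypothesis_imp` — and the verdict adds «true for `c ≤ 0` too
by the sign argument, but that is not what is landed».  This section settles the slopes `c ≤ 0`
(and, on the way, every `c < 2`) IN THE KERNEL, and the answer is the opposite one: for `c ≤ 0` the
bare law is FALSE in both worlds, so §3's equivalence at such a slope reads `False ↔ ¬RH`, i.e. it
is EQUIVALENT TO RH — not unconditional.  Two tree facts do the work.  In an RH world the two-sided
law `log_log_inv_weilGroundEnergy_of_riemannHypothesis` (soloist; its lower half is the RH-free decay
law `weilGroundEnergy_exp_exp_decay`, slope `2`) gives `2a − K ≤ log (log (ε a)⁻¹)` eventually, which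
no affine bound of slope `c < 2` survives.  In a `¬RH` world the bottom is unbounded below along
arbitrarily large windows (`exists_frequently_weilGroundEnergy_lt_of_not_riemannHypothesis`, the
`Ω`-form of Bombieri's converse), and where `ε(a) < −exp (exp (K+1))` one has, `Real.log` reading
moduli, `log (log (ε a)⁻¹) = log (log |ε a|) > K + 1 > c·a + K` for `a ≥ 0`, `c ≤ 0`.  No new
analysis; 0 definitions. -/

/-- **In an RH world the bare law FAILS for every slope `c < 2`.**  Under RH,
`2a − K₁ ≤ log (log (ε a)⁻¹)` for all large `a` (tree `log_log_inv_weilGroundEnergy_of_riemannHypothesis`,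
whose lower half is the unconditional decay law `ε(a) ≤ C exp(−c e^{2a})`); with `log (log (ε a)⁻¹) ≤ c·a + K`
this forces `(2 − c)·a ≤ K + K₁` for all large `a` — impossible for `c < 2`.
[this track (theory-1 gen15), HANDOFF-STATEMENT §J.30; referee HS-35 (c)] -/
theorem not_lowerSlope_of_riemannHypothesis_of_lt_two (hRH : _root_.RiemannHypothesis) {c : ℝ}
    (hc : c < 2) :
    ¬ ∃ K a₀ : ℝ, ∀ a : ℝ, a₀ ≤ a →
        Real.log (Real.log (weilGroundEnergy a)⁻¹) ≤ c * a + K := by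
  rintro ⟨K, a₀, h⟩
  obtain ⟨A, K₁, a₁, _, h₁⟩ := log_log_inv_weilGroundEnergy_of_riemannHypothesis hRH
  have h2c : 0 < 2 - c := by linarith
  set a : ℝ := max (max a₀ a₁) ((K + K₁) / (2 - c) + 1) with ha
  have hA : Real.log (Real.log (weilGroundEnergy a)⁻¹) ≤ c * a + K :=
    h a (le_trans (le_max_left _ _) (le_max_left _ _))
  have hB : 2 * a - K₁ ≤ Real.log (Real.log (weilGroundEnergy a)⁻¹) :=
    (h₁ a (le_trans (le_max_right _ _) (le_max_left _ _))).2.1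
  have hge : (K + K₁) / (2 - c) + 1 ≤ a := le_max_right _ _
  have h3 : ((K + K₁) / (2 - c) + 1) * (2 - c) ≤ a * (2 - c) :=
    mul_le_mul_of_nonneg_right hge h2c.le
  have h4 : ((K + K₁) / (2 - c) + 1) * (2 - c) = K + K₁ + (2 - c) := by
    field_simp
  rw [h4] at h3
  nlinarith

/-- Contrapositive, hypothesis-free in `c` below `2`: **a proof of the bare lower slope law with ANY
slope `c < 2` is a disproof of RH.** [this track (theory-1 gen15), HANDOFF-STATEMENT §J.30] -/
theorem not_riemannHypothesis_of_lowerSlope_of_lt_two {c : ℝ} (hc : c < 2)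
    (h : ∃ K a₀ : ℝ, ∀ a : ℝ, a₀ ≤ a →
        Real.log (Real.log (weilGroundEnergy a)⁻¹) ≤ c * a + K) :
    ¬ _root_.RiemannHypothesis :=
  fun hRH ↦ not_lowerSlope_of_riemannHypothesis_of_lt_two hRH hc h

/-- **For slopes `0 < c < 2` the bare lower slope law IS `¬RH`.**  («→»: the previous theorem;
«←»: §2, the `¬RH`-triviality for every `c > 0`.)  So in the band `(0, 2)` the bare sentence is not
«silent» but an exact synonym of the NEGATION of RH — proving it refutes RH, refuting it proves RH;
it is as hard as RH and says nothing new. [this track (theory-1 gen15), HANDOFF-STATEMENT §J.30] -/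
theorem lowerSlope_iff_not_riemannHypothesis {c : ℝ} (h0 : 0 < c) (h2 : c < 2) :
    (∃ K a₀ : ℝ, ∀ a : ℝ, a₀ ≤ a →
        Real.log (Real.log (weilGroundEnergy a)⁻¹) ≤ c * a + K) ↔
      ¬ _root_.RiemannHypothesis :=
  ⟨not_riemannHypothesis_of_lowerSlope_of_lt_two h2,
    fun h ↦ log_log_inv_weilGroundEnergy_le_of_not_riemannHypothesis h h0⟩

/-- **In a `¬RH` world the bare law FAILS for every slope `c ≤ 0`.**  Under `¬RH` the bottom drops
below every level on arbitrarily large windows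
(`exists_frequently_weilGroundEnergy_lt_of_not_riemannHypothesis`); at a window `a ≥ max a₀ 0` with
`ε(a) < −M`, `M = exp (exp (K+1))`, one has `log |ε a| > exp (K+1) > 0`, hence
`log (log (ε a)⁻¹) = log (−log |ε a|) = log (log |ε a|) > K + 1 ≥ c·a + K + 1`.
[this track (theory-1 gen15), HANDOFF-STATEMENT §J.30; referee HS-35 (c)] -/
theorem not_lowerSlope_of_not_riemannHypothesis_of_nonpos (hRH : ¬ _root_.RiemannHypothesis)
    {c : ℝ} (hc : c ≤ 0) :
    ¬ ∃ K a₀ : ℝ, ∀ a : ℝ, a₀ ≤ a →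
        Real.log (Real.log (weilGroundEnergy a)⁻¹) ≤ c * a + K := by
  rintro ⟨K, a₀, h⟩
  obtain ⟨κ, hκ, hfr⟩ := exists_frequently_weilGroundEnergy_lt_of_not_riemannHypothesis hRH
  set M : ℝ := Real.exp (Real.exp (K + 1)) with hM
  obtain ⟨a, ha, hlt⟩ := Filter.frequently_atTop.1 (hfr M) (max a₀ 0)
  have ha₀ : a₀ ≤ a := le_trans (le_max_left _ _) ha
  have ha0 : 0 ≤ a := le_trans (le_max_right _ _) ha
  have hMpos : 0 < M := Real.exp_pos _
  have hexp1 : 1 ≤ Real.exp (κ * a) := Real.one_le_exp (mul_nonneg hκ.le ha0)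
  have hMle : M ≤ M * Real.exp (κ * a) := le_mul_of_one_le_right hMpos.le hexp1
  have hεlt : weilGroundEnergy a < -M := by linarith
  have hεneg : weilGroundEnergy a < 0 := by linarith
  have habs : |weilGroundEnergy a| = -weilGroundEnergy a := abs_of_neg hεneg
  have hMabs : M < |weilGroundEnergy a| := by rw [habs]; linarith
  have hlogM : Real.log M = Real.exp (K + 1) := by rw [hM, Real.log_exp]
  have hlog_gt : Real.exp (K + 1) < Real.log |weilGroundEnergy a| := by
    rw [← hlogM]; exact Real.log_lt_log hMpos hMabs
  have hpos : 0 < Real.log |weilGroundEnergy a| := lt_trans (Real.exp_pos _) hlog_gt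
  -- the inner logarithm is `-log |ε a|`, and `Real.log` of it reads its modulus
  have hL : Real.log (weilGroundEnergy a)⁻¹ = -Real.log |weilGroundEnergy a| := by
    rw [Real.log_inv, Real.log_abs]
  have hout : Real.log (Real.log (weilGroundEnergy a)⁻¹) =
      Real.log (Real.log |weilGroundEnergy a|) := by
    rw [hL, ← Real.log_abs (-Real.log |weilGroundEnergy a|), abs_neg, abs_of_pos hpos]
  have hgt : K + 1 < Real.log (Real.log (weilGroundEnergy a)⁻¹) := by
    rw [hout, ← Real.log_exp (K + 1)]
    exact Real.log_lt_log (Real.exp_pos _) hlog_gt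
  have hca : c * a ≤ 0 := by nlinarith
  linarith [h a ha₀]

/-! ## §6  The table: `c ≤ 0` false · `0 < c < 2` ⟺ `¬RH` · `c ≥ 2` §3 — and the sign-aware law below `2` -/

/-- **The bare lower slope law with a NON-POSITIVE slope is FALSE, unconditionally** (classical case
split: RH — §5, `c < 2`; `¬RH` — §5, `c ≤ 0`).  So the sentence
`∃ K a₀, ∀ a ≥ a₀, log (log (ε a)⁻¹) ≤ c·a + K` with `c ≤ 0` is refuted in the kernel with no
hypothesis on the zeros. [this track (theory-1 gen15), HANDOFF-STATEMENT §J.30; referee HS-35 (c)] -/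
theorem not_lowerSlope_of_nonpos {c : ℝ} (hc : c ≤ 0) :
    ¬ ∃ K a₀ : ℝ, ∀ a : ℝ, a₀ ≤ a →
        Real.log (Real.log (weilGroundEnergy a)⁻¹) ≤ c * a + K := by
  by_cases hRH : _root_.RiemannHypothesis
  · exact not_lowerSlope_of_riemannHypothesis_of_lt_two hRH (by linarith)
  · exact not_lowerSlope_of_not_riemannHypothesis_of_nonpos hRH hc

/-- **Referee HS-35 (c), settled: for `c ≤ 0` the equivalence of §3 is EQUIVALENT TO RH** (not
unconditional).  Its left side is `False` (`not_lowerSlope_of_nonpos`), so «bare law ↔ (RH → bare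
law)» reads `False ↔ ¬RH`, i.e. `RH`.  (For `0 < c` the equivalence IS unconditional, §3; in the
band `0 < c < 2` both of its sides are `¬RH`, §5.) [this track (theory-1 gen15), HANDOFF-STATEMENT
§J.30; referee HS-35 (c)] -/
theorem lowerSlope_iff_imp_iff_riemannHypothesis_of_nonpos {c : ℝ} (hc : c ≤ 0) :
    ((∃ K a₀ : ℝ, ∀ a : ℝ, a₀ ≤ a →
          Real.log (Real.log (weilGroundEnergy a)⁻¹) ≤ c * a + K) ↔
        (_root_.RiemannHypothesis → ∃ K a₀ : ℝ, ∀ a : ℝ, a₀ ≤ a →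
          Real.log (Real.log (weilGroundEnergy a)⁻¹) ≤ c * a + K)) ↔
      _root_.RiemannHypothesis := by
  have hF := not_lowerSlope_of_nonpos hc
  refine ⟨fun h ↦ ?_, fun hRH ↦ ⟨fun h _ ↦ h, fun h ↦ h hRH⟩⟩
  by_contra hRH
  exact hF (h.2 fun hR ↦ absurd hR hRH)

/-- **The SIGN-AWARE law is FALSE for every slope `c < 2`, unconditionally**: it implies RH (§4),
and in an RH world its bare part fails below slope `2` (§5).  With §4 this completes the table for
the tree's typing: FALSE for `c < 2`; `RH ∧ (an open RH-world size statement)` for `2 ≤ c < A`;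
`⟺ RH` for `c ≥ A` (`exists_slope_signAware_iff_riemannHypothesis`, whence `A ≥ 2` in any RH
world).  Route R-E′'s slopes `(1+θ)·max(2, 1/(πc)) + θ > 2` sit in the middle band, as they must.
[this track (theory-1 gen15), HANDOFF-STATEMENT §J.30] -/
theorem not_signAware_lowerSlope_of_lt_two {c : ℝ} (hc : c < 2) :
    ¬ ∃ K a₀ : ℝ, ∀ a : ℝ, a₀ ≤ a →
        0 < weilGroundEnergy a ∧ Real.log (Real.log (weilGroundEnergy a)⁻¹) ≤ c * a + K := by
  intro h
  obtain ⟨hRH, hbare⟩ := (signAware_lowerSlope_iff c).1 h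
  exact not_lowerSlope_of_riemannHypothesis_of_lt_two hRH hc hbare

end Summit.RiemannHypothesis.RiemannHypothesis.Theorems.HandoffLowerSlope

end
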